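import Summits.Ventures.HodgeRepro2.T5SU11ReductionOfOrder
import Summits.Ventures.HodgeRepro2.T5SU11SphericalODE

/-!
# The solution space of the radial equation of `SU(1,1)` at EVERY real `λ`: `φ_λ(a_t)` and its reduction-of-order companion

Row 443 (`T5SU11ReductionOfOrder`) turns one positive solution of `sinh 2t · u″ + 2 cosh 2t · u′ = μ sinh 2t · u`
on `(0, ∞)` into the whole solution space. The spherical function `φ_λ(a_t) = sph λ (a_t)` is such a solution for
EVERY real `λ`, with `μ = λ(λ − 2)`: it is positive (row 335's `sph_hyp_pos`) and twice differentiable with the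
radial equation in the form `sinh 2t · φ″ + 2 cosh 2t · φ′ = λ(λ − 2) sinh 2t · φ` (row 342's `sph_hyp_ode`, here
with `φ′ = deriv`, `φ″ = deriv (deriv …)`: `hasDerivAt_deriv_sph_hyp`, `sph_hyp_ode_deriv`). Hence, with

  **`ψ_λ(t) := φ_λ(a_t) · ∫_1^t ds/(sinh 2s · φ_λ(a_s)²)`**  (`sphSecond`),

* `ψ_λ` solves the radial equation on `(0, ∞)` (`sphSecond_ode`), with `sinh 2t · (φ_λ ψ_λ′ − φ_λ′ ψ_λ) = 1`
  (`wronskian_sphSecond`), `ψ_λ(1) = 0`, `ψ_λ > 0` on `(1, ∞)`, `ψ_λ < 0` on `(0, 1)`;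
* **the solution space at every `λ` is two-dimensional**: every solution `u` on `(0, ∞)` is
  `u = (u(1)/φ_λ(a_1)) φ_λ(a_·) + sinh 2 · (φ_λ(a_1) u′(1) − φ_λ′(1) u(1)) ψ_λ` (`eq_add_of_ode`,
  `exists_eq_add_of_ode`), also in the classical form `u″ + 2 coth 2t · u′ = λ(λ − 2) u` with `deriv`
  (`exists_eq_add_of_ode_deriv`); a solution is determined by its value and derivative at `t = 1`
  (`eq_of_ode_of_eq_one`);
* at `λ = 2n + 2` the second-kind solution of row 441 is identified: **`Q_n(cosh 2t) = (Q_n(cosh 2)/P_n(cosh 2)) ·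
  φ_{2n+2}(a_t) − 2 ψ_{2n+2}(t)`** (`sphQ_eq`; the coefficient `−2` is row 441's Wronskian `−2/sinh 2t` against
  the normalised Wronskian `1/sinh 2t` of `ψ`).

Nothing is claimed about (N).

Blind lane: Mathlib + the HodgeRepro2 prefix only; no sorry; axioms ⊆ {propext, Classical.choice,
Quot.sound}.
-/

namespace Summit.Ventures.HodgeRepro2.T5SU11SphericalSolutionSpaceAll

open Filter Topology
open Set (Ioi)
open scoped Real
open T5SU11Cartan T5SU11SphericalFunction T5SU11SphericalBounds T5SU11SphericalDeriv T5SU11SphericalODE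
  T5SU11ReductionOfOrder T5SU11SphericalSolutionSpace T5SU11SphericalSecondKind T5SU11SphericalLegendreAll

section measure

variable [MeasurableSpace Circle] [BorelSpace Circle]

/-! ### The spherical function as a twice differentiable solution, with `deriv` -/

/-- `t ↦ φ_λ(a_t)` has derivative `deriv (φ_λ ∘ a)` everywhere. -/
theorem hasDerivAt_sph_hyp_deriv (lam t : ℝ) :
    HasDerivAt (fun t => sph lam (hyp t)) (deriv (fun t => sph lam (hyp t)) t) t :=
  (hasDerivAt_sph_hyp lam t).differentiableAt.hasDerivAt

/-- `deriv (φ_λ ∘ a)` has derivative `deriv (deriv (φ_λ ∘ a))` everywhere. -/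
theorem hasDerivAt_deriv_sph_hyp (lam t : ℝ) :
    HasDerivAt (deriv fun t => sph lam (hyp t)) (deriv (deriv fun t => sph lam (hyp t)) t) t := by
  have e : deriv (fun t => sph lam (hyp t)) = fun t => (2 * π)⁻¹ * ∫ φ in (-π)..π,
      (2 * Real.sinh (2 * t) - 2 * Real.cosh (2 * t) * Real.cos φ) * (-lam / 2) *
        (Real.cosh (2 * t) - Real.sinh (2 * t) * Real.cos φ) ^ (-lam / 2 - 1) :=
    funext (deriv_sph_hyp lam)
  rw [e]
  exact ((hasDerivAt_integral_laplace_deriv (-lam / 2) t).const_mul _).differentiableAt.hasDerivAt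

/-- **The radial equation with `deriv`**: `sinh 2t · (φ_λ ∘ a)″ + 2 cosh 2t · (φ_λ ∘ a)′ = λ(λ − 2) sinh 2t · φ_λ(a_t)`
for every `t`. -/
theorem sph_hyp_ode_deriv (lam t : ℝ) :
    Real.sinh (2 * t) * deriv (deriv fun t => sph lam (hyp t)) t
      + 2 * Real.cosh (2 * t) * deriv (fun t => sph lam (hyp t)) t
      = lam * (lam - 2) * Real.sinh (2 * t) * sph lam (hyp t) := by
  rw [deriv_deriv_sph_hyp, deriv_sph_hyp]
  exact sph_hyp_ode lam t

/-- The derivative data of `φ_λ ∘ a` on `(0, ∞)`, in the form row 443 consumes. -/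
theorem hφ_sph (lam : ℝ) : ∀ t, 0 < t →
    HasDerivAt (fun t => sph lam (hyp t)) (deriv (fun t => sph lam (hyp t)) t) t :=
  fun t _ => hasDerivAt_sph_hyp_deriv lam t

/-- The second-derivative data of `φ_λ ∘ a` on `(0, ∞)`. -/
theorem hφ'_sph (lam : ℝ) : ∀ t, 0 < t →
    HasDerivAt (deriv fun t => sph lam (hyp t)) (deriv (deriv fun t => sph lam (hyp t)) t) t :=
  fun t _ => hasDerivAt_deriv_sph_hyp lam t

/-- Positivity of `φ_λ ∘ a` on `(0, ∞)`. -/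
theorem hpos_sph (lam : ℝ) : ∀ t, 0 < t → 0 < sph lam (hyp t) := fun t _ => sph_hyp_pos lam t

/-- The radial equation of `φ_λ ∘ a` on `(0, ∞)`, in the form row 443 consumes. -/
theorem hode_sph (lam : ℝ) : ∀ t, 0 < t →
    Real.sinh (2 * t) * deriv (deriv fun t => sph lam (hyp t)) t
      + 2 * Real.cosh (2 * t) * deriv (fun t => sph lam (hyp t)) t
      = lam * (lam - 2) * Real.sinh (2 * t) * sph lam (hyp t) :=
  fun t _ => sph_hyp_ode_deriv lam t

/-! ### The second spherical solution -/

/-- **`ψ_λ(t) = φ_λ(a_t) · ∫_1^t ds/(sinh 2s · φ_λ(a_s)²)`**, the reduction-of-order companion of `φ_λ`. -/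
noncomputable def sphSecond (lam t : ℝ) : ℝ := secondSolution (fun t => sph lam (hyp t)) t

/-- `ψ_λ′`, the derivative of `ψ_λ` (row 443's formula). -/
noncomputable def sphSecond' (lam t : ℝ) : ℝ :=
  secondSolution' (fun t => sph lam (hyp t)) (deriv fun t => sph lam (hyp t)) t

/-- `ψ_λ″`, the second derivative of `ψ_λ` (row 443's formula). -/
noncomputable def sphSecond'' (lam t : ℝ) : ℝ :=
  secondSolution'' (fun t => sph lam (hyp t)) (deriv fun t => sph lam (hyp t))
    (deriv (deriv fun t => sph lam (hyp t))) t

omit [BorelSpace Circle] in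
/-- `ψ_λ(1) = 0`. -/
theorem sphSecond_one (lam : ℝ) : sphSecond lam 1 = 0 := secondSolution_one _

omit [BorelSpace Circle] in
/-- `ψ_λ′(1) = 1/(sinh 2 · φ_λ(a_1))`. -/
theorem sphSecond'_one (lam : ℝ) : sphSecond' lam 1 = (Real.sinh (2 * 1) * sph lam (hyp 1))⁻¹ :=
  secondSolution'_one _ _

/-- `ψ_λ′` is the derivative of `ψ_λ` on `(0, ∞)`. -/
theorem hasDerivAt_sphSecond (lam : ℝ) {t : ℝ} (ht : 0 < t) : HasDerivAt (sphSecond lam) (sphSecond' lam t) t :=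
  hasDerivAt_secondSolution (hφ_sph lam) (hpos_sph lam) ht

/-- `ψ_λ″` is the derivative of `ψ_λ′` on `(0, ∞)`. -/
theorem hasDerivAt_sphSecond' (lam : ℝ) {t : ℝ} (ht : 0 < t) :
    HasDerivAt (sphSecond' lam) (sphSecond'' lam t) t :=
  hasDerivAt_secondSolution' (hφ_sph lam) (hφ'_sph lam) (hpos_sph lam) ht

/-- **`ψ_λ` solves the radial equation** `sinh 2t · ψ″ + 2 cosh 2t · ψ′ = λ(λ − 2) sinh 2t · ψ` on `(0, ∞)`. -/
theorem sphSecond_ode (lam : ℝ) {t : ℝ} (ht : 0 < t) :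
    Real.sinh (2 * t) * sphSecond'' lam t + 2 * Real.cosh (2 * t) * sphSecond' lam t
      = lam * (lam - 2) * Real.sinh (2 * t) * sphSecond lam t :=
  secondSolution_ode (hpos_sph lam) (hode_sph lam) ht

/-- **The Wronskian** `sinh 2t · (φ_λ ψ_λ′ − φ_λ′ ψ_λ) = 1` on `(0, ∞)`. -/
theorem wronskian_sphSecond (lam : ℝ) {t : ℝ} (ht : 0 < t) :
    Real.sinh (2 * t) * (sph lam (hyp t) * sphSecond' lam t
      - deriv (fun t => sph lam (hyp t)) t * sphSecond lam t) = 1 :=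
  wronskian_secondSolution (hpos_sph lam) ht

/-- `ψ_λ > 0` on `(1, ∞)`. -/
theorem sphSecond_pos (lam : ℝ) {t : ℝ} (ht : 1 < t) : 0 < sphSecond lam t :=
  secondSolution_pos (hφ_sph lam) (hpos_sph lam) ht

/-- `ψ_λ < 0` on `(0, 1)`. -/
theorem sphSecond_neg (lam : ℝ) {t : ℝ} (ht0 : 0 < t) (ht : t < 1) : sphSecond lam t < 0 :=
  secondSolution_neg (hφ_sph lam) (hpos_sph lam) ht0 ht

/-! ### The solution space at every `λ` -/

/-- **THE SOLUTION SPACE AT EVERY `λ`, with explicit constants**: every solution `u` of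
`sinh 2t · u″ + 2 cosh 2t · u′ = λ(λ − 2) sinh 2t · u` on `(0, ∞)` is
`(u(1)/φ_λ(a_1)) · φ_λ(a_t) + sinh 2 · (φ_λ(a_1) u′(1) − φ_λ′(1) u(1)) · ψ_λ(t)`. -/
theorem eq_add_of_ode (lam : ℝ) {u u' u'' : ℝ → ℝ}
    (hu : ∀ t, 0 < t → HasDerivAt u (u' t) t) (hu' : ∀ t, 0 < t → HasDerivAt u' (u'' t) t)
    (hode : ∀ t, 0 < t → Real.sinh (2 * t) * u'' t + 2 * Real.cosh (2 * t) * u' t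
      = lam * (lam - 2) * Real.sinh (2 * t) * u t) {t : ℝ} (ht : 0 < t) :
    u t = (u 1 / sph lam (hyp 1)) * sph lam (hyp t)
      + (Real.sinh 2 * (sph lam (hyp 1) * u' 1 - deriv (fun t => sph lam (hyp t)) 1 * u 1)) * sphSecond lam t :=
  T5SU11ReductionOfOrder.eq_add_of_ode (hφ_sph lam) (hφ'_sph lam) (hpos_sph lam) (hode_sph lam) hu hu' hode ht

/-- **THE SOLUTION SPACE AT EVERY `λ` IS TWO-DIMENSIONAL**: every solution on `(0, ∞)` is `a φ_λ(a_·) + b ψ_λ`. -/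
theorem exists_eq_add_of_ode (lam : ℝ) {u u' u'' : ℝ → ℝ}
    (hu : ∀ t, 0 < t → HasDerivAt u (u' t) t) (hu' : ∀ t, 0 < t → HasDerivAt u' (u'' t) t)
    (hode : ∀ t, 0 < t → Real.sinh (2 * t) * u'' t + 2 * Real.cosh (2 * t) * u' t
      = lam * (lam - 2) * Real.sinh (2 * t) * u t) :
    ∃ a b : ℝ, ∀ t, 0 < t → u t = a * sph lam (hyp t) + b * sphSecond lam t :=
  T5SU11ReductionOfOrder.exists_eq_add_of_ode (hφ_sph lam) (hφ'_sph lam) (hpos_sph lam) (hode_sph lam) hu hu' hode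

/-- **Uniqueness at every `λ`**: two solutions with the same value and derivative at `t = 1` agree on `(0, ∞)`. -/
theorem eq_of_ode_of_eq_one (lam : ℝ) {u u' u'' w w' w'' : ℝ → ℝ}
    (hu : ∀ t, 0 < t → HasDerivAt u (u' t) t) (hu' : ∀ t, 0 < t → HasDerivAt u' (u'' t) t)
    (huode : ∀ t, 0 < t → Real.sinh (2 * t) * u'' t + 2 * Real.cosh (2 * t) * u' t
      = lam * (lam - 2) * Real.sinh (2 * t) * u t)
    (hw : ∀ t, 0 < t → HasDerivAt w (w' t) t) (hw' : ∀ t, 0 < t → HasDerivAt w' (w'' t) t)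
    (hwode : ∀ t, 0 < t → Real.sinh (2 * t) * w'' t + 2 * Real.cosh (2 * t) * w' t
      = lam * (lam - 2) * Real.sinh (2 * t) * w t)
    (h0 : u 1 = w 1) (h1 : u' 1 = w' 1) {t : ℝ} (ht : 0 < t) : u t = w t :=
  T5SU11ReductionOfOrder.eq_of_ode_of_eq_one (hφ_sph lam) (hφ'_sph lam) (hpos_sph lam) (hode_sph lam)
    hu hu' huode hw hw' hwode h0 h1 ht

/-- **The classical form**: if `u` is twice differentiable on `(0, ∞)` with
`u″ + 2 coth 2t · u′ = λ(λ − 2) u` there (`deriv` throughout), then `u = a φ_λ(a_·) + b ψ_λ` on `(0, ∞)`. -/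
theorem exists_eq_add_of_ode_deriv (lam : ℝ) {u : ℝ → ℝ}
    (hu : ∀ t, 0 < t → DifferentiableAt ℝ u t) (hu' : ∀ t, 0 < t → DifferentiableAt ℝ (deriv u) t)
    (hode : ∀ t, 0 < t → deriv (deriv u) t + 2 * (Real.cosh (2 * t) / Real.sinh (2 * t)) * deriv u t
      = lam * (lam - 2) * u t) :
    ∃ a b : ℝ, ∀ t, 0 < t → u t = a * sph lam (hyp t) + b * sphSecond lam t := by
  refine exists_eq_add_of_ode lam (fun t ht => (hu t ht).hasDerivAt) (fun t ht => (hu' t ht).hasDerivAt) ?_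
  intro t ht
  have hS : Real.sinh (2 * t) ≠ 0 := (sinh_two_mul_pos ht).ne'
  have h := hode t ht
  have e : Real.sinh (2 * t) * (2 * (Real.cosh (2 * t) / Real.sinh (2 * t)) * deriv u t)
      = 2 * Real.cosh (2 * t) * deriv u t := by
    field_simp
  linear_combination Real.sinh (2 * t) * h - e

/-! ### `λ = 2n + 2`: the second-kind solution of row 441 in terms of `ψ` -/

/-- `(d/dt) φ_{2n+2}(a_t)` at `t = 1`, in closed form. -/
theorem deriv_sph_even_hyp_one (n : ℕ) :
    deriv (fun t => sph (2 * (n : ℝ) + 2) (hyp t)) 1 = 2 * Real.sinh (2 * 1) * legQ n (Real.cosh (2 * 1)) :=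
  (hasDerivAt_sph_even_hyp n 1).deriv

/-- **`Q_n(cosh 2t)` in the basis `φ_{2n+2}(a_·), ψ_{2n+2}`**:
`Q_n(cosh 2t) = (Q_n(cosh 2)/P_n(cosh 2)) · φ_{2n+2}(a_t) − 2 ψ_{2n+2}(t)` on `(0, ∞)`. -/
theorem sphQ_eq (n : ℕ) {t : ℝ} (ht : 0 < t) :
    sphQ n t = (sphQ n 1 / sph (2 * (n : ℝ) + 2) (hyp 1)) * sph (2 * (n : ℝ) + 2) (hyp t)
      - 2 * sphSecond (2 * (n : ℝ) + 2) t := by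
  have h := eq_add_of_ode (2 * (n : ℝ) + 2) (fun t ht => hasDerivAt_sphQ n ht.ne')
    (fun t ht => hasDerivAt_sphQ' n ht.ne') (fun t ht => sphQ_ode n ht.ne') ht
  have hW := wronskian_sphQ n (one_ne_zero : (1 : ℝ) ≠ 0)
  have hS : Real.sinh (2 * 1) ≠ 0 := (sinh_two_mul_pos one_pos).ne'
  have hb : Real.sinh 2 * (sph (2 * (n : ℝ) + 2) (hyp 1) * sphQ' n 1
      - deriv (fun t => sph (2 * (n : ℝ) + 2) (hyp t)) 1 * sphQ n 1) = -2 := by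
    rw [deriv_sph_even_hyp_one, hW]
    norm_num
    field_simp
  rw [h, hb]
  ring

end measure

end Summit.Ventures.HodgeRepro2.T5SU11SphericalSolutionSpaceAll
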